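import Summits.HubbardSuperconductivity.HubbardSuperconductivity.Theses.ParityLeeYang
import Literature.MathematicalPhysics.QuantumLattice.HubbardParityBandBottom

/-!
# Route `ParityLeeYang`, support `BandBottomOnAxis` (stmt-HubbardSuperconductivity-8386)

On the torus `(ℤ/Lℤ)²`, `L ≥ 2`, `t = 1`: for EVERY `U > 0` there is `β₁` such that for all
`β ≥ β₁` some `μ` has `Re Tr[parityOp · e^{-β(H - μN)}] < 0`, `H - μN = hubbardTorusWith 2 L 1 U μ`
— repulsion splits the Kramers-double fugacity zero at the non-degenerate band bottom along the real
axis. This is the torus instance of the Literature theorem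
`Literature…HubbardBandBottom.parityTrace_neg_of_connected` (any finite connected graph; Perron–
Frobenius for the band bottom, the strict two-particle gap `E₂ > 2E₁`, Pauli sector bounds and the
sector-sum form of the parity-twisted partition function, files
`Literature/MathematicalPhysics/QuantumLattice/HubbardBandBottom*.lean`, `HubbardParity*.lean`); the
torus graph is connected (`fermionTorus_reflTransGen`). No definitions.
Sources: the route card (parity-twisted `Z` as a sign datum, Tasaki–Watanabe 2021); Lieb–Wu 2003 §2.
-/

set_option linter.dupNamespace false

namespace Summit.HubbardSuperconductivity.HubbardSuperconductivity.Theorems.ParityLeeYang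

open Matrix Finset Literature.MathematicalPhysics.QuantumLattice
  Literature.MathematicalPhysics.QuantumLattice.HubbardBandBottom

open Summit.HubbardSuperconductivity.HubbardSuperconductivity.Theses.ParityLeeYang in
/-- **`BandBottomOnAxis` holds** (route `ParityLeeYang`, item `stmt-HubbardSuperconductivity-8386`):
on the torus `(ℤ/Lℤ)²`, `L ≥ 2`, `t = 1`, for EVERY `U > 0` there is `β₁` such that for all
`β ≥ β₁` some `μ` has `Re Tr[parityOp · e^{-β(H - μN)}] < 0` — repulsion splits the Kramers-double
fugacity zero at the non-degenerate band bottom along the real axis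
(`parityTrace_neg_of_connected` on the connected torus graph). [folklore] -/
theorem bandBottomOnAxis_proof : BandBottomOnAxis := by
  intro L hL U hU
  haveI : NeZero L := ⟨by omega⟩
  haveI : Nonempty (FermionTorus 2 L) := ⟨toLex fun _ => ⟨0, by omega⟩⟩
  obtain ⟨β₁, h⟩ := parityTrace_neg_of_connected (fermionTorusGraph 2 L) fermionTorus_reflTransGen hU
  refine ⟨β₁, fun β hβ => ?_⟩
  obtain ⟨μ, hμ⟩ := h β hβ
  refine ⟨μ, ?_⟩
  -- `hubbardTorusWith 2 L 1 U μ` is `hamiltonianWith (fermionTorusGraph 2 L) 1 U μ` by definition; the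
  -- `DecidableEq` instances on the occupation basis reached through `LinearOrder` and directly agree
  -- only propositionally (`Subsingleton.elim`), whence `convert`.
  convert hμ using 6
  rfl

end Summit.HubbardSuperconductivity.HubbardSuperconductivity.Theorems.ParityLeeYang
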